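import Summits.CriticalPhenomena.Ising3D.TaylorRegionDeltaLitEven
import Mathlib.Tactic.Linarith
import Mathlib.Tactic.Positivity
import Mathlib.Tactic.Ring
import HarnessLib

/-!
# Discriminant-only pieces for the literal-table even region (−30 % kernel work per piece)
(cell `pub-ising3x`, seat recog-1 gen 13; gate (g2) — kernel measurements HOME/pub-ising3x-recog-1/gen13/KERNEL-DELTA.md)

HONEST FRAMING: lottery ticket; floor = tightest certified 3D Ising CFT bounds; no exact-solution
claim without a proof. Island framing: certified exclusion region at stated derivative order and
assumptions; not a determination of the 3D Ising critical exponents beyond that.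

The piece Boolean of `taylorEvenRegion_of_splitΔL` runs three bisections per piece: `posOn3` for `X̂`, `posOn3` for
`Ŷ` and the product-free discriminant `posOnDE3` — but every node of `posOnDE3` already decides `0 < lowB3 X` and
`0 < lowB3 Y`, which is exactly the core test of `posOn3`. MEASURED on a real `Λ = 11` row (61 leaves): 272 s of kernel
for the 8 pieces, ≈ 30 % of it in the two redundant bisections. This file: `posOn3_of_posOnDE3_fst/snd` (a passing
discriminant bisection contains passing `X̂`/`Ŷ` bisections of the same depth), the discriminant-only piece Booleans
**`pieceRowOKD` / `pieceOKBD`**, `pieceOKB_of_pieceOKBD`, and the front-end **`taylorEvenRegion_of_splitΔLD`**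
(= `taylorEvenRegion_of_splitΔL` with the cheaper pieces). Elementary. [folklore]
-/

namespace Summit.CriticalPhenomena.Ising3D

open Finset Set
open Literature.Analysis.ValidatedNumerics Literature.Analysis.ValidatedNumerics.PolyMP
open Literature.Analysis.ValidatedNumerics.NumericsMP (MI)
open Literature.MathematicalPhysics.QuantumFieldTheory.ConformalBootstrap3D

/-- The core test of `posOn3` is the first conjunct of the core test of `posOnDE3`. [folklore] -/
theorem posCore3_of_posCoreDE3_fst {S : ℕ} {TX TY TZ : ITriple} {lo hi Wx Wy Wz : ℚ}
    (h : posCoreDE3 S TX TY TZ lo hi Wx Wy Wz = true) : posCore3 S TX.1 TX.2.1 TX.2.2 lo hi Wx = true := by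
  simp only [posCoreDE3, Bool.and_eq_true, decide_eq_true_eq] at h
  simp only [posCore3, decide_eq_true_eq]
  have h1 := h.1.1
  simp only [lowB3] at h1
  linarith

/-- [folklore] -/
theorem posCore3_of_posCoreDE3_snd {S : ℕ} {TX TY TZ : ITriple} {lo hi Wx Wy Wz : ℚ}
    (h : posCoreDE3 S TX TY TZ lo hi Wx Wy Wz = true) : posCore3 S TY.1 TY.2.1 TY.2.2 lo hi Wy = true := by
  simp only [posCoreDE3, Bool.and_eq_true, decide_eq_true_eq] at h
  simp only [posCore3, decide_eq_true_eq]
  have h1 := h.1.2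
  simp only [lowB3] at h1
  linarith

/-- **A passing discriminant bisection contains a passing `X̂` bisection of the same depth.** [folklore] -/
theorem posOn3_of_posOnDE3_fst {S : ℕ} {TX TY TZ : ITriple} {Wx Wy Wz : ℚ} :
    ∀ (d : ℕ) (a b : ℚ), posOnDE3 S TX TY TZ Wx Wy Wz d a b = true → posOn3 S TX.1 TX.2.1 TX.2.2 Wx d a b = true
  | 0, _, _, h => posCore3_of_posCoreDE3_fst h
  | d + 1, _, _, h => by
      simp only [posOnDE3, Bool.or_eq_true, Bool.and_eq_true] at h
      simp only [posOn3, Bool.or_eq_true, Bool.and_eq_true]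
      rcases h with h | ⟨ha, hb⟩
      · exact Or.inl (posCore3_of_posCoreDE3_fst h)
      · exact Or.inr ⟨posOn3_of_posOnDE3_fst d _ _ ha, posOn3_of_posOnDE3_fst d _ _ hb⟩

/-- **… and a passing `Ŷ` bisection.** [folklore] -/
theorem posOn3_of_posOnDE3_snd {S : ℕ} {TX TY TZ : ITriple} {Wx Wy Wz : ℚ} :
    ∀ (d : ℕ) (a b : ℚ), posOnDE3 S TX TY TZ Wx Wy Wz d a b = true → posOn3 S TY.1 TY.2.1 TY.2.2 Wy d a b = true
  | 0, _, _, h => posCore3_of_posCoreDE3_snd h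
  | d + 1, _, _, h => by
      simp only [posOnDE3, Bool.or_eq_true, Bool.and_eq_true] at h
      simp only [posOn3, Bool.or_eq_true, Bool.and_eq_true]
      rcases h with h | ⟨ha, hb⟩
      · exact Or.inl (posCore3_of_posCoreDE3_snd h)
      · exact Or.inr ⟨posOn3_of_posOnDE3_snd d _ _ ha, posOn3_of_posOnDE3_snd d _ _ hb⟩

namespace EvenRegionDataΔ

variable (d : EvenRegionDataΔ)

/-- ONE piece of row `j`, DISCRIMINANT-ONLY form (chunk-file form: one literal row triple, one row's breakpoints). [folklore] -/
def pieceRowOKD (Lj : ITriple × ITriple × ITriple) (Bj : List ℚ) (j k : ℕ) : Bool :=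
  decide (d.E1 < max d.E0 (j : ℚ)) ||
    posOnDE3 d.S Lj.1 Lj.2.1 Lj.2.2 d.Wσ d.Wε d.Wb d.dPj (d.bpRow Bj j k) (d.bpRow Bj j (k + 1))

/-- ONE piece of row `j` with producer breakpoints, discriminant-only form. [folklore] -/
def pieceOKBD (L : List (ITriple × ITriple × ITriple)) (B : List (List ℚ)) (j k : ℕ) : Bool :=
  d.pieceRowOKD (L.getD j noLit3) (B.getD j []) j k

/-- The discriminant-only piece implies the landed three-bisection piece. [folklore] -/
theorem pieceRowOK_of_pieceRowOKD {Lj : ITriple × ITriple × ITriple} {Bj : List ℚ} {j k : ℕ}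
    (h : d.pieceRowOKD Lj Bj j k = true) : d.pieceRowOK Lj Bj j k = true := by
  simp only [pieceRowOKD, Bool.or_eq_true] at h
  simp only [pieceRowOK, Bool.or_eq_true, Bool.and_eq_true]
  rcases h with h | h
  · exact Or.inl h
  · exact Or.inr ⟨⟨posOn3_of_posOnDE3_fst _ _ _ h, posOn3_of_posOnDE3_snd _ _ _ h⟩, h⟩

/-- [folklore] -/
theorem pieceOKB_of_pieceOKBD {L : List (ITriple × ITriple × ITriple)} {B : List (List ℚ)} {j k : ℕ}
    (h : d.pieceOKBD L B j k = true) : d.pieceOKB L B j k = true :=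
  d.pieceRowOK_of_pieceRowOKD h

end EvenRegionDataΔ

/-- **The even region over a wide box from literal tables, discriminant-only pieces.** [folklore] -/
theorem taylorEvenRegion_of_splitΔLD (d : EvenRegionDataΔ) (LP LT : IPoly2 × IPoly2 × IPoly2 × IPoly2)
    (TT : ITab3 × ITab3 × ITab3 × ITab3) (L : List (ITriple × ITriple × ITriple)) (B : List (List ℚ))
    (hl : d.l.Nodup) (hs : d.sizesOK = true)
    (hnX : 0 < d.prmX.nθ) (hnY : 0 < d.prmY.nθ) (hlen : d.tailLenOK LT = true)
    (hPD : ∀ c : ℕ, c < 4 → d.pdLitOK LP c = true)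
    (hmom : ∀ c r : ℕ, c < 4 → r < d.R → d.momRowLitOK LP LT c r = true)
    (hX : ∀ k : ℕ, k < d.prmX.nθ → d.tailXCellOKL LT k = true)
    (hY : ∀ k : ℕ, k < d.prmY.nθ → d.tailYCellOKL LT k = true)
    (hD : ∀ k : ℕ, k < d.prmD.nθ → d.toH.tailDCellOKL (EvenRegionDataΔ.tailLT LT) k = true)
    (hT : ∀ c m : ℕ, c < 4 → m < 3 → d.tabOKc TT c m = true)
    (hr : ∀ j : ℕ, j < d.J1 + 1 → d.rowLitOKL TT L j = true)
    (hpc : ∀ j k : ℕ, j < d.J1 + 1 → k < numPieces B j → d.pieceOKBD L B j k = true) :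
    TaylorEvenRegion (taylorCrossing (1 / 2) (1 / 2) d.l.toFinset fun i ab => (d.cQ i ab : ℝ))
      (Icc (d.σlo : ℝ) d.σhi ×ˢ Icc (d.εlo : ℝ) d.εhi) ((d.E0 : ℚ) : ℝ) :=
  taylorEvenRegion_of_splitΔL d LP LT TT L B hl hs hnX hnY hlen hPD hmom hX hY hD hT hr
    fun j k hj hk => d.pieceOKB_of_pieceOKBD (hpc j k hj hk)

namespace TaylorTable

variable (T : TaylorTable)

/-- **The table's even region from the literal-table Booleans with discriminant-only pieces.** [folklore] -/
theorem evenRegion_of_splitΔLD (π : EvenRegionParamsΔ) (LP LT : IPoly2 × IPoly2 × IPoly2 × IPoly2)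
    (TT : ITab3 × ITab3 × ITab3 × ITab3) (L : List (ITriple × ITriple × ITriple)) (B : List (List ℚ))
    (hl : (T.evenDataΔ π).l.Nodup) (hs : (T.evenDataΔ π).sizesOK = true) (hnX : 0 < (T.evenDataΔ π).prmX.nθ)
    (hnY : 0 < (T.evenDataΔ π).prmY.nθ) (hlen : (T.evenDataΔ π).tailLenOK LT = true)
    (hPD : ∀ c : ℕ, c < 4 → (T.evenDataΔ π).pdLitOK LP c = true)
    (hmom : ∀ c r : ℕ, c < 4 → r < (T.evenDataΔ π).R → (T.evenDataΔ π).momRowLitOK LP LT c r = true)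
    (hX : ∀ k : ℕ, k < (T.evenDataΔ π).prmX.nθ → (T.evenDataΔ π).tailXCellOKL LT k = true)
    (hY : ∀ k : ℕ, k < (T.evenDataΔ π).prmY.nθ → (T.evenDataΔ π).tailYCellOKL LT k = true)
    (hD : ∀ k : ℕ, k < (T.evenDataΔ π).prmD.nθ →
      (T.evenDataΔ π).toH.tailDCellOKL (EvenRegionDataΔ.tailLT LT) k = true)
    (hT : ∀ c m : ℕ, c < 4 → m < 3 → (T.evenDataΔ π).tabOKc TT c m = true)
    (hr : ∀ j : ℕ, j < (T.evenDataΔ π).J1 + 1 → (T.evenDataΔ π).rowLitOKL TT L j = true)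
    (hp : ∀ j k : ℕ, j < (T.evenDataΔ π).J1 + 1 → k < numPieces B j → (T.evenDataΔ π).pieceOKBD L B j k = true) :
    TaylorEvenRegion T.α T.box ((T.E₀ : ℚ) : ℝ) :=
  taylorEvenRegion_of_splitΔLD (T.evenDataΔ π) LP LT TT L B hl hs hnX hnY hlen hPD hmom hX hY hD hT hr hp

end TaylorTable

end Summit.CriticalPhenomena.Ising3D
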